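import Literature.AnabelianGeometry.Anabelioids.InductionStar
import Mathlib.Topology.Algebra.OpenSubgroup
import Mathlib.CategoryTheory.Galois.Topology
import Mathlib.GroupTheory.Index
import HarnessLib

/-!
# Anabelioids: `π₁(B(G))` is the profinite completion of `G` ([GeoAn] §1.1, [SemiAnbd] §3)

Mochizuki, *The geometry of anabelioids*, Publ. RIMS **40** (2004), §1.1 p. 9
[cite: MochizukiGeoAn2004, §1.1 p.9], and *Semi-graphs of anabelioids*, Publ. RIMS **42** (2006),
§3 (Prop. 3.6 (iii) p. 38: "`π₁^temp(G) ↪ π̂₁(G)`", the finite objects of `B^temp` giving the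
profinite completion).  For an ARBITRARY topological group `G`, the automorphism group of the
forgetful basepoint of `B(G) = ContAction FintypeCat G` (finite sets with continuous `G`-action) is
the profinite completion of `G`: there is a canonical continuous homomorphism
`ι : G → Aut(forget)`, `g ↦ (ρ_X(g))_X`, whose

* kernel is the intersection of the open normal subgroups of finite index
  (`exists_completion_aut_forget`, clause 2),
* image is dense: any automorphism is matched by some `ι g` on any finitely many objects
  (clause 3 — naturality along the orbit maps out of a coset object `G/M`, `M` the open normal
  finite-index kernel of the action on those objects),
* and for which the closure of `ι(U)`, `U ⊆ G` open of finite index, is OPEN (clause 4: it is the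
  stabiliser of the base point of the coset object `G/U`).

For compact totally disconnected `G`, `ι` is the isomorphism of `BCatFundamentalGroup.lean`.
Proof-only file (no definitions).
-/

noncomputable section

namespace Literature.AnabelianGeometry.Anabelioids

open CategoryTheory CategoryTheory.Limits CategoryTheory.PreGaloisCategory
open Literature.AlgebraicGeometry.Frobenioids (BCat)
open scoped Pointwise Topology FintypeCatDiscrete
open Induction

universe u

section

variable {G : Type u} [Group G] [TopologicalSpace G] [IsTopologicalGroup G]

/-- Naturality of an automorphism of the forgetful basepoint along an orbit map `G/N → X`:
`σ_X(x) = g • x` whenever `gN = σ_{G/N}(eN)`. [folklore] -/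
private theorem aut_app_eq_orbit'
    (σ : Aut (ObjectProperty.ι (Action.IsContinuous (V := FintypeCat.{u}) (G := G)) ⋙
      Action.forget FintypeCat.{u} G))
    (X : BCat G) (x : X.obj.V) (N : Subgroup G) [Finite (G ⧸ N)] (hN : IsOpen (N : Set G))
    (hle : N ≤ MulAction.stabilizer G x) (g : G)
    (hg : ((g : G ⧸ N) : (quotObj N hN).obj.V) = (σ.hom.app (quotObj N hN)).hom (basePt N hN)) :
    (σ.hom.app X).hom x = g • x := by
  have nat := σ.hom.naturality (orbitHom X x N hN hle)
  have h := ConcreteCategory.congr_hom nat (basePt N hN)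
  change (σ.hom.app X).hom ((orbitHom X x N hN hle).hom.hom (((1 : G) : G ⧸ N) : _)) =
    (orbitHom X x N hN hle).hom.hom ((σ.hom.app (quotObj N hN)).hom (basePt N hN)) at h
  rw [orbitHom_mk, one_smul, ← hg, orbitHom_mk] at h
  exact h

omit [IsTopologicalGroup G] in
/-- The automorphism group of a finite `G`-set is finite. [folklore] -/
private theorem finite_aut_V (X : BCat G) : Finite (Aut X.obj.V) :=
  Finite.of_injective (fun σ : Aut X.obj.V => fun x : X.obj.V => σ.hom.hom x) fun σ τ h => by
    apply Iso.ext
    apply FintypeCat.hom_ext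
    intro x
    exact congrFun h x

/-- The kernel of the action on a finite continuous `G`-set: an open normal subgroup of finite
index contained in all stabilisers. [folklore] -/
private theorem exists_openNormal_le_stabilizer (X : BCat G) :
    ∃ K : OpenNormalSubgroup G, Finite (G ⧸ K.toSubgroup) ∧
      (∀ x : X.obj.V, K.toSubgroup ≤ MulAction.stabilizer G x) ∧
      ∀ g : G, g ∈ K.toSubgroup → X.obj.ρ g = 𝟙 _ := by
  classical
  let f : G →* Aut X.obj.V := Action.ρAut X.obj
  have hker : ∀ g : G, g ∈ f.ker ↔ ∀ x : X.obj.V, g • x = x := by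
    intro g
    rw [MonoidHom.mem_ker]
    constructor
    · intro h x
      have := congrArg (fun σ : Aut X.obj.V => σ.hom.hom x) h
      exact this
    · intro h
      apply Iso.ext
      apply FintypeCat.hom_ext
      intro x
      exact h x
  have hopen : IsOpen (f.ker : Set G) := by
    have hI : IsOpen (⋂ x : X.obj.V, (MulAction.stabilizer G x : Set G)) :=
      isOpen_iInter_of_finite fun x => (isContinuous_iff X.obj).mp X.property x
    have hmem : (f.ker : Set G) ∈ 𝓝 (1 : G) :=
      Filter.mem_of_superset
        (hI.mem_nhds (Set.mem_iInter.mpr fun x => (MulAction.stabilizer G x).one_mem))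
        (fun g hg => (hker g).mpr fun x => Set.mem_iInter.mp hg x)
    exact Subgroup.isOpen_of_mem_nhds f.ker hmem
  haveI : Finite (Aut X.obj.V) := finite_aut_V X
  have hfin : Finite (G ⧸ f.ker) :=
    Finite.of_equiv _ (QuotientGroup.quotientKerEquivRange f).symm.toEquiv
  refine ⟨{ toSubgroup := f.ker, isOpen' := hopen, isNormal' := inferInstance }, hfin,
    fun x g hg => ?_, fun g hg => ?_⟩
  · exact (hker g).mp hg x
  · have h1 : f g = 1 := MonoidHom.mem_ker.mp hg
    calc X.obj.ρ g = (f g).hom := rfl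
      _ = (1 : Aut X.obj.V).hom := by rw [h1]
      _ = 𝟙 _ := rfl

/-- A common open normal finite-index subgroup acting trivially on finitely many objects.
[folklore] -/
private theorem exists_openNormal_le_stabilizers (S : Finset (BCat G)) :
    ∃ M : OpenNormalSubgroup G, Finite (G ⧸ M.toSubgroup) ∧
      ∀ X ∈ S, ∀ x : X.obj.V, M.toSubgroup ≤ MulAction.stabilizer G x := by
  classical
  induction S using Finset.induction_on with
  | empty =>
    refine ⟨{ toOpenSubgroup := ⊤, isNormal' := ⟨fun n _ g => Subgroup.mem_top _⟩ }, ?_,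
      fun X hX => (Finset.notMem_empty X hX).elim⟩
    haveI : (((⊤ : OpenSubgroup G) : Subgroup G)).FiniteIndex := by
      change (⊤ : Subgroup G).FiniteIndex
      infer_instance
    exact Subgroup.finite_quotient_of_finiteIndex
  | insert X S hXS ih =>
    obtain ⟨M, hM, hMS⟩ := ih
    obtain ⟨K, hK, hKX, -⟩ := exists_openNormal_le_stabilizer X
    haveI : M.toSubgroup.FiniteIndex := @Subgroup.finiteIndex_of_finite_quotient _ _ _ hM
    haveI : K.toSubgroup.FiniteIndex := @Subgroup.finiteIndex_of_finite_quotient _ _ _ hK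
    refine ⟨M ⊓ K, ?_, ?_⟩
    · change Finite (G ⧸ (M.toSubgroup ⊓ K.toSubgroup))
      exact Subgroup.finite_quotient_of_finiteIndex
    · intro Y hY y
      rcases Finset.mem_insert.mp hY with rfl | hY
      · exact le_trans (inf_le_right : M.toSubgroup ⊓ K.toSubgroup ≤ K.toSubgroup) (hKX y)
      · exact le_trans (inf_le_left : M.toSubgroup ⊓ K.toSubgroup ≤ M.toSubgroup) (hMS Y hY y)

/-- **`π₁(B(G)) = Ĝ`**: for any topological group `G`, the action homomorphism
`ι : G → Aut(forget : B(G) → FinSets)` is continuous, has kernel the intersection of the open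
normal subgroups of finite index, has dense image (it matches any automorphism on any finitely many
objects), and `closure (ι U)` is open for every open subgroup `U` of finite index.
[cite: MochizukiGeoAn2004, §1.1 p.9] -/
theorem exists_completion_aut_forget :
    ∃ ι : G →ₜ* Aut (ObjectProperty.ι (Action.IsContinuous (V := FintypeCat.{u}) (G := G)) ⋙
        Action.forget FintypeCat.{u} G),
      (∀ (g : G) (X : BCat G), (ι g).hom.app X = X.obj.ρ g) ∧
      (∀ g : G, ι g = 1 ↔
        ∀ N : OpenNormalSubgroup G, Finite (G ⧸ N.toSubgroup) → g ∈ N.toSubgroup) ∧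
      (∀ (σ : Aut (ObjectProperty.ι (Action.IsContinuous (V := FintypeCat.{u}) (G := G)) ⋙
          Action.forget FintypeCat.{u} G)) (S : Finset (BCat G)),
        ∃ g : G, ∀ X ∈ S, (ι g).hom.app X = σ.hom.app X) ∧
      (∀ U : Subgroup G, IsOpen (U : Set G) → U.FiniteIndex →
        IsOpen (closure (SetLike.coe (U.map ι.toMonoidHom)))) := by
  classical
  -- (a) the action homomorphism and its continuity
  let ρ₀ : G → Aut (ObjectProperty.ι (Action.IsContinuous (V := FintypeCat.{u}) (G := G)) ⋙
      Action.forget FintypeCat.{u} G) := fun g =>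
    NatIso.ofComponents (fun X => Action.ρAut X.obj g) (fun {X Y} f => (f.hom.comm g).symm)
  let ρ : G →* Aut (ObjectProperty.ι (Action.IsContinuous (V := FintypeCat.{u}) (G := G)) ⋙
      Action.forget FintypeCat.{u} G) :=
    { toFun := ρ₀
      map_one' := by
        apply Iso.ext
        apply NatTrans.ext
        funext X
        change X.obj.ρ 1 = 𝟙 _
        rw [map_one]
        rfl
      map_mul' := fun g h => by
        apply Iso.ext
        apply NatTrans.ext
        funext X
        change X.obj.ρ (g * h) = X.obj.ρ h ≫ X.obj.ρ g
        rw [map_mul]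
        rfl }
  have hρ : ∀ (g : G) (X : BCat G), (ρ g).hom.app X = X.obj.ρ g := fun g X => rfl
  have hcont : Continuous ρ := by
    refine continuous_induced_rng.2 (continuous_pi fun X => ?_)
    refine continuous_discrete_rng.2 fun b => ?_
    rw [isOpen_iff_forall_mem_open]
    intro g₀ hg₀
    obtain ⟨K, -, -, hK⟩ := exists_openNormal_le_stabilizer X
    refine ⟨(fun k => g₀ * k) '' (K : Set G), ?_, isOpenMap_mul_left g₀ _ K.isOpen',
      ⟨1, K.toSubgroup.one_mem, mul_one g₀⟩⟩
    rintro _ ⟨k, hk, rfl⟩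
    have hk1 : X.obj.ρ k = 1 := hK k hk
    have key : autEmbedding _ (ρ (g₀ * k)) X = autEmbedding _ (ρ g₀) X := by
      apply Iso.ext
      change (ρ (g₀ * k)).hom.app X = (ρ g₀).hom.app X
      rw [hρ, hρ, map_mul, hk1, mul_one]
    have hb : autEmbedding _ (ρ g₀) X = b := hg₀
    change autEmbedding _ (ρ (g₀ * k)) X ∈ ({b} : Set _)
    rw [key, hb]
    exact Set.mem_singleton b
  let ι : G →ₜ* Aut (ObjectProperty.ι (Action.IsContinuous (V := FintypeCat.{u}) (G := G)) ⋙
      Action.forget FintypeCat.{u} G) :=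
    { ρ with continuous_toFun := hcont }
  have hι : ∀ (g : G) (X : BCat G), (ι g).hom.app X = X.obj.ρ g := fun g X => rfl
  -- (c) approximation on finitely many objects
  have happrox : ∀ (σ : Aut (ObjectProperty.ι (Action.IsContinuous (V := FintypeCat.{u}) (G := G)) ⋙
      Action.forget FintypeCat.{u} G)) (S : Finset (BCat G)),
      ∃ g : G, ∀ X ∈ S, (ι g).hom.app X = σ.hom.app X := by
    intro σ S
    obtain ⟨M, hM, hMS⟩ := exists_openNormal_le_stabilizers S
    haveI := hM
    obtain ⟨g, hg⟩ := QuotientGroup.mk_surjective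
      ((σ.hom.app (quotObj M.toSubgroup M.isOpen')).hom (basePt M.toSubgroup M.isOpen'))
    refine ⟨g, fun X hX => ?_⟩
    apply FintypeCat.hom_ext
    intro x
    change X.obj.V at x
    change (X.obj.ρ g).hom x = (σ.hom.app X).hom x
    exact (aut_app_eq_orbit' σ X x M.toSubgroup M.isOpen' (hMS X hX x) g hg).symm
  refine ⟨ι, hι, fun g => ⟨fun hg N hN => ?_, fun hg => ?_⟩, happrox, fun U hU hUfi => ?_⟩
  -- (b ⇒) the coset objects separate
  · haveI := hN
    have h1 := congrArg (fun σ : Aut (ObjectProperty.ι (Action.IsContinuous (V := FintypeCat.{u}) (G := G)) ⋙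
        Action.forget FintypeCat.{u} G) =>
      σ.hom.app (quotObj N.toSubgroup N.isOpen')) hg
    have h2 := ConcreteCategory.congr_hom h1 (basePt N.toSubgroup N.isOpen')
    change ((quotObj N.toSubgroup N.isOpen').obj.ρ g).hom (basePt N.toSubgroup N.isOpen') =
      basePt N.toSubgroup N.isOpen' at h2
    change (((g * 1 : G)) : G ⧸ N.toSubgroup) = (((1 : G)) : G ⧸ N.toSubgroup) at h2
    rw [mul_one, QuotientGroup.eq, mul_one, inv_mem_iff] at h2
    exact h2
  -- (b ⇐) an element of every open normal finite-index subgroup acts trivially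
  · apply Iso.ext
    apply NatTrans.ext
    funext X
    obtain ⟨K, hK, -, hKρ⟩ := exists_openNormal_le_stabilizer X
    change X.obj.ρ g = 𝟙 _
    exact hKρ g (hg K hK)
  -- (d) closure of `ι U` is the stabiliser of the base point of `G/U`, which is clopen
  · haveI : Finite (G ⧸ U) := Subgroup.finite_quotient_of_finiteIndex
    let Q : BCat G := quotObj U hU
    let F := (ObjectProperty.ι (Action.IsContinuous (V := FintypeCat.{u}) (G := G)) ⋙
      Action.forget FintypeCat.{u} G)
    have hev : Continuous (fun σ : Aut F => autEmbedding F σ Q) :=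
      (continuous_apply Q).comp continuous_induced_dom
    let T : Set (Aut (F.obj Q)) := {τ | τ.hom.hom (basePt U hU) = basePt U hU}
    let V : Set (Aut F) := (fun σ : Aut F => autEmbedding F σ Q) ⁻¹' T
    have hVopen : IsOpen V := (isOpen_discrete T).preimage hev
    have hVclosed : IsClosed V := (isClosed_discrete T).preimage hev
    -- membership of `ι g` in `V` is membership of `g` in `U`
    have hιV : ∀ g : G, ι g ∈ V ↔ g ∈ U := by
      intro g
      change ((ι g).hom.app Q).hom (basePt U hU) = basePt U hU ↔ g ∈ U
      change ((quotObj U hU).obj.ρ g).hom (basePt U hU) = basePt U hU ↔ g ∈ U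
      change (((g * 1 : G)) : G ⧸ U) = (((1 : G)) : G ⧸ U) ↔ g ∈ U
      rw [mul_one, QuotientGroup.eq, mul_one, inv_mem_iff]
    have hsub : SetLike.coe (U.map ι.toMonoidHom) ⊆ V := by
      rintro _ ⟨g, hg, rfl⟩
      exact (hιV g).mpr hg
    suffices heq : closure (SetLike.coe (U.map ι.toMonoidHom)) = V by
      rw [heq]; exact hVopen
    apply Set.Subset.antisymm (closure_minimal hsub hVclosed)
    intro σ hσ
    rw [mem_closure_iff]
    intro O hO hσO
    -- unpack the open set of the induced product topology around `σ`
    obtain ⟨O', hO', rfl⟩ := isOpen_induced_iff.mp hO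
    obtain ⟨I, w, hw, hIO⟩ := isOpen_pi_iff.mp hO' _ hσO
    obtain ⟨g, hg⟩ := happrox σ (insert Q I)
    have hgU : g ∈ U := by
      rw [← hιV]
      change ((ι g).hom.app Q).hom (basePt U hU) = basePt U hU
      rw [hg Q (Finset.mem_insert_self Q I)]
      exact hσ
    refine ⟨ι g, hIO (Set.mem_pi.mpr fun X hX => ?_), ⟨g, hgU, rfl⟩⟩
    have hXI : X ∈ I := hX
    have happ : autEmbedding F (ι g) X = autEmbedding F σ X := by
      apply Iso.ext
      exact hg X (Finset.mem_insert_of_mem hXI)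
    rw [happ]
    exact (hw X hXI).2

end

end Literature.AnabelianGeometry.Anabelioids

end
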